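import Literature.Analysis.ValidatedNumerics.TaylorModelL2
import Mathlib.Analysis.SpecialFunctions.Integrals.Basic
import Mathlib.Analysis.SpecialFunctions.Pow.Asymptotics
import Mathlib.Analysis.SpecialFunctions.Log.NegMulLog
import HarnessLib

/-!
# Logarithmic moments `∫₀ᴸ sᵃ log s`, `∫₀ᴸ sᵃ log² s` and the `L²` norm over a panel carrying a logarithmic edge singularity

Trunk T-ANA (Analysis/ValidatedNumerics); namespace `Literature.Analysis.ValidatedNumerics.PolyMP`.
Sequel of `TaylorModelL2.lean`.  A validated function on an EDGE panel `s ∈ (0, 2h]` of the form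

  `R(s) = −½ q(s) log s + T(h − s)`,   `q` an exact rational polynomial, `T` Taylor-modelled on `|ρ| ≤ h`,

(the window image of a windowed trial vector near the window's edge: `q(s) = g(c − s)` and `−½ log s` the singular part
of the tail `Ψ(s)` of the archimedean density) has an EXPLICITLY bounded squared `L²` norm: with `p` a rational reference
polynomial for `T`, `δ = tabsI S h (P − p)/S`, `ℓ = log(2h)` and the exact rational "power moments"
`pm_r[f] = Σ_a f_a (2h)^{a+1}/(a+1)^r` (`powMomQ`),

  `∫₀^{2h} R² ≤ ¼(pm₁[q²]ℓ² − 2pm₂[q²]ℓ + 2pm₃[q²]) − (pm₁[q·p̃]ℓ − pm₂[q·p̃]) + ∫_{-h}^{h}p² + δ‖q‖·2h(1−ℓ) + 2h(2‖p‖δ + δ²)`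

(`integral_sq_logEdge_le`; `p̃(s) = p(h − s) = Poly.shift p h`), resting on the closed forms
`∫₀ᴸ sᵃ log s ds = L^{a+1}(log L/(a+1) − 1/(a+1)²)` (`integral_pow_mul_log`) and
`∫₀ᴸ sᵃ log² s ds = L^{a+1}(log² L/(a+1) − 2 log L/(a+1)² + 2/(a+1)³)` (`integral_pow_mul_log_sq`, `0 < L ≤ 1`), their
polynomial versions (`integral_poly_mul_log`, `integral_poly_mul_log_sq`) and `∫₀ᴸ (−log s) ds = L(1 − log L)`.
Also the SUB-PANEL form of the plain `L²` rule (`integral_sq_le_of_tmem_sub`: `∫_a^b f² ≤ [∫_a^b p²] + (b−a)(2‖p‖δ+δ²)` for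
`-h ≤ a ≤ b ≤ h`, needed when a panel must be cut at an enclosed breakpoint).  Problem-independent; no facts, no axioms.

## References

* K. Makino, M. Berz, *Taylor models and other validated functional inclusion methods*, Int. J. Pure Appl. Math. 4
  (2003) 379–456, §6. [folklore]
* I. S. Gradshteyn, I. M. Ryzhik, *Table of Integrals, Series, and Products*, 2.723 (`∫ xⁿ logᵐ x`). [folklore]
-/

open MeasureTheory intervalIntegral Set Filter
open scoped Interval Topology

namespace Literature.Analysis.ValidatedNumerics

namespace PolyMP

open Literature.Analysis.ValidatedNumerics.NumericsMP
open Literature.Analysis.ValidatedNumerics.ExpPoly (Poly)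
open Literature.Analysis.ValidatedNumerics.ExpPoly

/-! ### Elementary facts about `log` near `0⁺` -/

/-- `−log s ≤ 4 s^{-1/4}` for `s > 0`. [folklore] -/
theorem neg_log_le_four_mul_rpow {s : ℝ} (hs : 0 < s) : -Real.log s ≤ 4 * s ^ (-(1 / 4 : ℝ)) := by
  have h1 : Real.log (s ^ (-(1 / 4 : ℝ))) ≤ s ^ (-(1 / 4 : ℝ)) - 1 :=
    Real.log_le_sub_one_of_pos (Real.rpow_pos_of_pos hs _)
  rw [Real.log_rpow hs] at h1
  linarith

/-- `log² s ≤ 16 s^{-1/2}` for `0 < s ≤ 1`. [folklore] -/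
theorem log_sq_le_rpow {s : ℝ} (hs : 0 < s) (hs1 : s ≤ 1) : Real.log s ^ 2 ≤ 16 * s ^ (-(1 / 2 : ℝ)) := by
  have hneg : Real.log s ≤ 0 := Real.log_nonpos hs.le hs1
  have h4 := neg_log_le_four_mul_rpow hs
  have h0 : 0 ≤ -Real.log s := by linarith
  have hsq : Real.log s ^ 2 = (-Real.log s) ^ 2 := by ring
  have hr : (s ^ (-(1 / 4 : ℝ))) ^ 2 = s ^ (-(1 / 2 : ℝ)) := by
    rw [← Real.rpow_natCast, ← Real.rpow_mul hs.le]; norm_num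
  rw [hsq, ← hr]
  nlinarith [Real.rpow_nonneg hs.le (-(1 / 4 : ℝ))]

/-! ### The monomial logarithmic moments -/

/-- `s ↦ sᵃ log s` is interval integrable on every `[0, L]`. [folklore] -/
theorem intervalIntegrable_pow_mul_log (a : ℕ) (L : ℝ) :
    IntervalIntegrable (fun s : ℝ => s ^ a * Real.log s) volume 0 L :=
  intervalIntegral.intervalIntegrable_log'.continuousOn_mul (continuousOn_pow a)

/-- **`∫₀ᴸ sᵃ log s ds = L^{a+1}(log L/(a+1) − 1/(a+1)²)`** for `L > 0`. [folklore] -/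
theorem integral_pow_mul_log (a : ℕ) {L : ℝ} (hL : 0 < L) :
    ∫ s in (0 : ℝ)..L, s ^ a * Real.log s =
      L ^ (a + 1) * (Real.log L / (a + 1) - 1 / (a + 1) ^ 2) := by
  have ha1 : (a : ℝ) + 1 ≠ 0 := by positivity
  have hderiv : ∀ s ∈ Ioo (0 : ℝ) L,
      HasDerivAt (fun s : ℝ => s ^ (a + 1) * (Real.log s / (a + 1) - 1 / (a + 1) ^ 2)) (s ^ a * Real.log s) s := by
    intro s hs
    have hs0 : s ≠ 0 := hs.1.ne'
    have h1 : HasDerivAt (fun s : ℝ => s ^ (a + 1)) (((a + 1 : ℕ) : ℝ) * s ^ a) s := by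
      simpa using hasDerivAt_pow (a + 1) s
    have h2 : HasDerivAt (fun s : ℝ => Real.log s / (a + 1) - 1 / (a + 1) ^ 2) (s⁻¹ / (a + 1)) s := by
      simpa using ((Real.hasDerivAt_log hs0).div_const ((a : ℝ) + 1)).sub_const (1 / ((a : ℝ) + 1) ^ 2)
    refine (h1.mul h2).congr_deriv ?_
    push_cast
    field_simp
    ring
  have h0 : Tendsto (fun s : ℝ => s ^ (a + 1) * (Real.log s / (a + 1) - 1 / (a + 1) ^ 2)) (𝓝[>] 0) (𝓝 0) := by
    -- `s^{a+1} log s = s^a · (log s · s) → 0` and `s^{a+1} → 0`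
    have ht : Tendsto (fun s : ℝ => Real.log s * s ^ (1 : ℝ)) (𝓝[>] 0) (𝓝 0) :=
      tendsto_log_mul_rpow_nhdsGT_zero zero_lt_one
    have hpow : Tendsto (fun s : ℝ => s ^ a) (𝓝[>] 0) (𝓝 (0 ^ a)) :=
      ((continuous_pow a).tendsto 0).mono_left nhdsWithin_le_nhds
    have hpow1 : Tendsto (fun s : ℝ => s ^ (a + 1)) (𝓝[>] 0) (𝓝 0) := by
      have := ((continuous_pow (a + 1)).tendsto (0 : ℝ)).mono_left (nhdsWithin_le_nhds (s := Ioi 0))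
      simpa using this
    have hprod : Tendsto (fun s : ℝ => s ^ a * (Real.log s * s ^ (1 : ℝ))) (𝓝[>] 0) (𝓝 (0 ^ a * 0)) :=
      hpow.mul ht
    rw [mul_zero] at hprod
    have hlim := (hprod.div_const ((a : ℝ) + 1)).sub (hpow1.div_const (((a : ℝ) + 1) ^ 2))
    rw [zero_div, zero_div, sub_zero] at hlim
    refine hlim.congr' ?_
    filter_upwards [self_mem_nhdsWithin] with s (hs : 0 < s)
    simp only [Real.rpow_one]
    ring
  have hLlim : Tendsto (fun s : ℝ => s ^ (a + 1) * (Real.log s / (a + 1) - 1 / (a + 1) ^ 2)) (𝓝[<] L)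
      (𝓝 (L ^ (a + 1) * (Real.log L / (a + 1) - 1 / (a + 1) ^ 2))) := by
    have hc : ContinuousAt (fun s : ℝ => s ^ (a + 1) * (Real.log s / (a + 1) - 1 / (a + 1) ^ 2)) L := by
      have : ContinuousAt (fun s : ℝ => Real.log s) L := Real.continuousAt_log hL.ne'
      exact ((continuous_pow (a + 1)).continuousAt).mul ((this.div_const _).sub continuousAt_const)
    exact hc.tendsto.mono_left nhdsWithin_le_nhds
  rw [integral_eq_sub_of_hasDerivAt_of_tendsto hL hderiv (intervalIntegrable_pow_mul_log a L) h0 hLlim, sub_zero]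

/-- `s ↦ sᵃ log² s` is interval integrable on `[0, L]` for `0 ≤ L ≤ 1` (`log² s ≤ 16 s^{-1/2}` there). [folklore] -/
theorem intervalIntegrable_pow_mul_log_sq (a : ℕ) {L : ℝ} (hL0 : 0 ≤ L) (hL1 : L ≤ 1) :
    IntervalIntegrable (fun s : ℝ => s ^ a * Real.log s ^ 2) volume 0 L := by
  have hg : IntervalIntegrable (fun s : ℝ => 16 * s ^ (-(1 / 2 : ℝ))) volume 0 L :=
    (intervalIntegral.intervalIntegrable_rpow' (by norm_num)).const_mul 16
  refine hg.mono_fun' ?_ ?_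
  · exact ((measurable_id.pow_const a).mul (Real.measurable_log.pow_const 2)).aestronglyMeasurable
  · rw [EventuallyLE, ae_restrict_iff' measurableSet_uIoc]
    refine Eventually.of_forall fun s hs => ?_
    rw [uIoc_of_le hL0] at hs
    have hs1 : s ≤ 1 := hs.2.trans hL1
    have hsa : s ^ a ≤ 1 := pow_le_one₀ hs.1.le hs1
    rw [Real.norm_eq_abs, abs_mul, abs_pow, abs_of_pos hs.1, abs_of_nonneg (sq_nonneg _)]
    calc s ^ a * Real.log s ^ 2 ≤ 1 * Real.log s ^ 2 :=
          mul_le_mul_of_nonneg_right hsa (sq_nonneg _)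
      _ ≤ 16 * s ^ (-(1 / 2 : ℝ)) := by rw [one_mul]; exact log_sq_le_rpow hs.1 hs1

/-- **`∫₀ᴸ sᵃ log² s ds = L^{a+1}(log² L/(a+1) − 2 log L/(a+1)² + 2/(a+1)³)`** for `0 < L ≤ 1`. [folklore] -/
theorem integral_pow_mul_log_sq (a : ℕ) {L : ℝ} (hL : 0 < L) (hL1 : L ≤ 1) :
    ∫ s in (0 : ℝ)..L, s ^ a * Real.log s ^ 2 =
      L ^ (a + 1) * (Real.log L ^ 2 / (a + 1) - 2 * Real.log L / (a + 1) ^ 2 + 2 / (a + 1) ^ 3) := by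
  have ha1 : (a : ℝ) + 1 ≠ 0 := by positivity
  have hderiv : ∀ s ∈ Ioo (0 : ℝ) L, HasDerivAt
      (fun s : ℝ => s ^ (a + 1) * (Real.log s ^ 2 / (a + 1) - 2 * Real.log s / (a + 1) ^ 2 + 2 / (a + 1) ^ 3))
      (s ^ a * Real.log s ^ 2) s := by
    intro s hs
    have hs0 : s ≠ 0 := hs.1.ne'
    have h1 : HasDerivAt (fun s : ℝ => s ^ (a + 1)) (((a + 1 : ℕ) : ℝ) * s ^ a) s := by
      simpa using hasDerivAt_pow (a + 1) s
    have hl := Real.hasDerivAt_log hs0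
    have h2 : HasDerivAt (fun s : ℝ => Real.log s ^ 2 / (a + 1) - 2 * Real.log s / (a + 1) ^ 2 + 2 / (a + 1) ^ 3)
        (((2 : ℕ) : ℝ) * Real.log s ^ (2 - 1) * s⁻¹ / (a + 1) - 2 * s⁻¹ / (a + 1) ^ 2) s := by
      have hA := (hl.pow 2).div_const ((a : ℝ) + 1)
      have hB := (hl.const_mul (2 : ℝ)).div_const (((a : ℝ) + 1) ^ 2)
      exact (hA.sub hB).add_const (2 / ((a : ℝ) + 1) ^ 3)
    refine (h1.mul h2).congr_deriv ?_
    push_cast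
    simp only [pow_one]
    field_simp
    ring
  have h0 : Tendsto
      (fun s : ℝ => s ^ (a + 1) * (Real.log s ^ 2 / (a + 1) - 2 * Real.log s / (a + 1) ^ 2 + 2 / (a + 1) ^ 3))
      (𝓝[>] 0) (𝓝 0) := by
    -- `log s · s^{1/2} → 0`, hence `log² s · s → 0`, hence every term tends to `0`
    have ht : Tendsto (fun s : ℝ => Real.log s * s ^ (1 / 2 : ℝ)) (𝓝[>] 0) (𝓝 0) :=
      tendsto_log_mul_rpow_nhdsGT_zero (by norm_num)
    have ht2 : Tendsto (fun s : ℝ => Real.log s ^ 2 * s) (𝓝[>] 0) (𝓝 0) := by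
      have h := ht.mul ht
      rw [mul_zero] at h
      refine h.congr' ?_
      filter_upwards [self_mem_nhdsWithin] with s (hs : 0 < s)
      have : s ^ (1 / 2 : ℝ) * s ^ (1 / 2 : ℝ) = s := by
        rw [← Real.rpow_add hs]; norm_num
      calc Real.log s * s ^ (1 / 2 : ℝ) * (Real.log s * s ^ (1 / 2 : ℝ))
          = Real.log s ^ 2 * (s ^ (1 / 2 : ℝ) * s ^ (1 / 2 : ℝ)) := by ring
        _ = Real.log s ^ 2 * s := by rw [this]
    have ht1 : Tendsto (fun s : ℝ => Real.log s * s) (𝓝[>] 0) (𝓝 0) := by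
      simpa [Real.rpow_one] using tendsto_log_mul_rpow_nhdsGT_zero zero_lt_one
    have hpow : Tendsto (fun s : ℝ => s ^ a) (𝓝[>] 0) (𝓝 (0 ^ a)) :=
      ((continuous_pow a).tendsto 0).mono_left nhdsWithin_le_nhds
    have hpow1 : Tendsto (fun s : ℝ => s ^ (a + 1)) (𝓝[>] 0) (𝓝 0) := by
      have := ((continuous_pow (a + 1)).tendsto (0 : ℝ)).mono_left (nhdsWithin_le_nhds (s := Ioi 0))
      simpa using this
    have hA : Tendsto (fun s : ℝ => s ^ a * (Real.log s ^ 2 * s)) (𝓝[>] 0) (𝓝 (0 ^ a * 0)) := hpow.mul ht2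
    have hB : Tendsto (fun s : ℝ => s ^ a * (Real.log s * s)) (𝓝[>] 0) (𝓝 (0 ^ a * 0)) := hpow.mul ht1
    rw [mul_zero] at hA hB
    have hlim := ((hA.div_const ((a : ℝ) + 1)).sub ((hB.const_mul (2 : ℝ)).div_const (((a : ℝ) + 1) ^ 2))).add
      ((hpow1.const_mul (2 : ℝ)).div_const (((a : ℝ) + 1) ^ 3))
    simp only [zero_div, mul_zero, sub_zero, add_zero] at hlim
    refine hlim.congr' ?_
    filter_upwards [self_mem_nhdsWithin] with s (hs : 0 < s)
    ring
  have hLlim : Tendsto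
      (fun s : ℝ => s ^ (a + 1) * (Real.log s ^ 2 / (a + 1) - 2 * Real.log s / (a + 1) ^ 2 + 2 / (a + 1) ^ 3))
      (𝓝[<] L) (𝓝 (L ^ (a + 1) * (Real.log L ^ 2 / (a + 1) - 2 * Real.log L / (a + 1) ^ 2 + 2 / (a + 1) ^ 3))) := by
    have hc : ContinuousAt
        (fun s : ℝ => s ^ (a + 1) * (Real.log s ^ 2 / (a + 1) - 2 * Real.log s / (a + 1) ^ 2 + 2 / (a + 1) ^ 3)) L := by
      have hl : ContinuousAt (fun s : ℝ => Real.log s) L := Real.continuousAt_log hL.ne'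
      exact ((continuous_pow (a + 1)).continuousAt).mul
        ((((hl.pow 2).div_const _).sub ((continuousAt_const.mul hl).div_const _)).add continuousAt_const)
    exact hc.tendsto.mono_left nhdsWithin_le_nhds
  rw [integral_eq_sub_of_hasDerivAt_of_tendsto hL hderiv (intervalIntegrable_pow_mul_log_sq a hL.le hL1) h0 hLlim,
    sub_zero]

/-- `∫₀ᴸ (−log s) ds = L(1 − log L)`. [folklore] -/
theorem integral_neg_log {L : ℝ} : ∫ s in (0 : ℝ)..L, -Real.log s = L * (1 - Real.log L) := by
  rw [intervalIntegral.integral_neg, integral_log]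
  simp only [zero_mul, sub_zero, add_zero]
  ring

/-! ### Polynomial logarithmic moments, exactly over `ℚ` -/

/-- `Σ_a cs[a] · L^{a₀+a+1}/(a₀+a+1)^r` — the power moments of a coefficient list started at exponent `a₀`. [folklore] -/
def powMomAux (L : ℚ) (r : ℕ) : ℕ → Poly → ℚ
  | _, [] => 0
  | a, c :: cs => c * L ^ (a + 1) / ((a : ℚ) + 1) ^ r + powMomAux L r (a + 1) cs

/-- `pm_r[f](L) = Σ_a f_a L^{a+1}/(a+1)^r` (so `∫₀ᴸ f = pm₀`... and the log moments below). [folklore] -/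
def powMomQ (f : Poly) (L : ℚ) (r : ℕ) : ℚ := powMomAux L r 0 f

/-- [folklore] -/
theorem integral_pow_mul_eval_mul_log (L : ℚ) (hL : 0 < (L : ℝ)) :
    ∀ (cs : Poly) (a : ℕ), ∫ s in (0 : ℝ)..L, s ^ a * Poly.eval cs s * Real.log s =
      (powMomAux L 1 a cs : ℝ) * Real.log L - (powMomAux L 2 a cs : ℝ)
  | [], a => by simp [powMomAux, Poly.eval]
  | c :: cs, a => by
      have ih := integral_pow_mul_eval_mul_log L hL cs (a + 1)
      have hI1 : IntervalIntegrable (fun s : ℝ => (c : ℝ) * (s ^ a * Real.log s)) volume 0 L :=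
        (intervalIntegrable_pow_mul_log a L).const_mul _
      have hI2 : IntervalIntegrable (fun s : ℝ => s ^ (a + 1) * Poly.eval cs s * Real.log s) volume 0 L := by
        have := (intervalIntegrable_pow_mul_log (a + 1) (L : ℝ)).continuousOn_mul (Poly.continuous_eval cs).continuousOn
        refine this.congr fun s _ => ?_
        ring
      have e : ∀ s : ℝ, s ^ a * Poly.eval (c :: cs) s * Real.log s =
          (c : ℝ) * (s ^ a * Real.log s) + s ^ (a + 1) * Poly.eval cs s * Real.log s := fun s => by
        rw [Poly.eval]; ring
      simp_rw [e]
      rw [intervalIntegral.integral_add hI1 hI2, intervalIntegral.integral_const_mul, integral_pow_mul_log a hL, ih]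
      simp only [powMomAux]
      push_cast
      ring

/-- **`∫₀ᴸ f(s) log s ds = pm₁[f] log L − pm₂[f]`** for a rational polynomial `f` and rational `L > 0`. [folklore] -/
theorem integral_poly_mul_log (f : Poly) {L : ℚ} (hL : 0 < L) :
    ∫ s in (0 : ℝ)..L, Poly.eval f s * Real.log s =
      (powMomQ f L 1 : ℝ) * Real.log L - (powMomQ f L 2 : ℝ) := by
  have h := integral_pow_mul_eval_mul_log L (by exact_mod_cast hL) f 0
  simp only [pow_zero, one_mul] at h
  exact h

/-- [folklore] -/
theorem integral_pow_mul_eval_mul_log_sq (L : ℚ) (hL : 0 < (L : ℝ)) (hL1 : (L : ℝ) ≤ 1) :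
    ∀ (cs : Poly) (a : ℕ), ∫ s in (0 : ℝ)..L, s ^ a * Poly.eval cs s * Real.log s ^ 2 =
      (powMomAux L 1 a cs : ℝ) * Real.log L ^ 2 - 2 * (powMomAux L 2 a cs : ℝ) * Real.log L +
        2 * (powMomAux L 3 a cs : ℝ)
  | [], a => by simp [powMomAux, Poly.eval]
  | c :: cs, a => by
      have ih := integral_pow_mul_eval_mul_log_sq L hL hL1 cs (a + 1)
      have hI1 : IntervalIntegrable (fun s : ℝ => (c : ℝ) * (s ^ a * Real.log s ^ 2)) volume 0 L :=
        (intervalIntegrable_pow_mul_log_sq a hL.le hL1).const_mul _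
      have hI2 : IntervalIntegrable (fun s : ℝ => s ^ (a + 1) * Poly.eval cs s * Real.log s ^ 2) volume 0 L := by
        have := (intervalIntegrable_pow_mul_log_sq (a + 1) hL.le hL1).continuousOn_mul
          (Poly.continuous_eval cs).continuousOn
        refine this.congr fun s _ => ?_
        ring
      have e : ∀ s : ℝ, s ^ a * Poly.eval (c :: cs) s * Real.log s ^ 2 =
          (c : ℝ) * (s ^ a * Real.log s ^ 2) + s ^ (a + 1) * Poly.eval cs s * Real.log s ^ 2 := fun s => by
        rw [Poly.eval]; ring
      simp_rw [e]
      rw [intervalIntegral.integral_add hI1 hI2, intervalIntegral.integral_const_mul, integral_pow_mul_log_sq a hL hL1, ih]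
      simp only [powMomAux]
      push_cast
      ring

/-- **`∫₀ᴸ f(s) log² s ds = pm₁[f] log² L − 2 pm₂[f] log L + 2 pm₃[f]`** (`0 < L ≤ 1`). [folklore] -/
theorem integral_poly_mul_log_sq (f : Poly) {L : ℚ} (hL : 0 < L) (hL1 : L ≤ 1) :
    ∫ s in (0 : ℝ)..L, Poly.eval f s * Real.log s ^ 2 =
      (powMomQ f L 1 : ℝ) * Real.log L ^ 2 - 2 * (powMomQ f L 2 : ℝ) * Real.log L + 2 * (powMomQ f L 3 : ℝ) := by
  have h := integral_pow_mul_eval_mul_log_sq L (by exact_mod_cast hL) (by exact_mod_cast hL1) f 0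
  simp only [pow_zero, one_mul] at h
  exact h

/-! ### Reflected polynomials -/

/-- `Poly.shift p c₀` evaluates to `p(c₀ − s)`. [folklore] -/
theorem eval_shift_eq (c0 : ℚ) (s : ℝ) : ∀ p : Poly, Poly.eval (Poly.shift p c0) s = Poly.eval p ((c0 : ℝ) - s)
  | [] => by simp [Poly.eval_shift_nil, Poly.eval]
  | c :: cs => by rw [Poly.eval_shift_cons, eval_shift_eq c0 s cs, Poly.eval]

/-! ### The sub-panel `L²` rule -/

/-- **Squared `L²` norm over a sub-panel** `[a, b] ⊆ [-h, h]`: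
`∫_a^b f² ≤ (A(b) − A(a)) + (b − a)(2‖p‖_h δ + δ²)` with `A = ad₀(p·p)` the exact antiderivative of `p²`,
`δ = tabsI S h (P − p)/S` — for panels that must be cut at an (enclosed, possibly irrational) breakpoint. [folklore] -/
theorem integral_sq_le_of_tmem_sub {S : ℕ} (hS : 0 < S) {h : ℚ} (h0 : 0 ≤ h) {f : ℝ → ℝ} {P : IPoly}
    (hf : TMem S h f P) (p : Poly) {a b : ℝ} (ha : -(h : ℝ) ≤ a) (hab : a ≤ b) (hb : b ≤ h)
    (hfi : IntervalIntegrable (fun ρ => f ρ ^ 2) volume a b) :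
    ∫ ρ in a..b, f ρ ^ 2 ≤
      (Poly.eval (Poly.ad 0 (Poly.mul p p)) b - Poly.eval (Poly.ad 0 (Poly.mul p p)) a) +
        (b - a) * (2 * absBoundQ p h * ((tabsI S h (tsubI P (ratPolyI S p)) : ℝ) / S) +
          ((tabsI S h (tsubI P (ratPolyI S p)) : ℝ) / S) ^ 2) := by
  set δ : ℝ := (tabsI S h (tsubI P (ratPolyI S p)) : ℝ) / S with hδ
  set K : ℝ := 2 * absBoundQ p h * δ + δ ^ 2 with hK
  have hpc : Continuous fun ρ => Poly.eval p ρ ^ 2 + K := ((Poly.continuous_eval p).pow 2).add continuous_const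
  have hmono : ∫ ρ in a..b, f ρ ^ 2 ≤ ∫ ρ in a..b, (Poly.eval p ρ ^ 2 + K) := by
    refine intervalIntegral.integral_mono_on hab hfi (hpc.intervalIntegrable _ _) fun ρ hρ => ?_
    exact sq_le_of_tmem hS h0 hf p (abs_le.2 ⟨by linarith [hρ.1], by linarith [hρ.2]⟩)
  refine hmono.trans (le_of_eq ?_)
  rw [intervalIntegral.integral_add (f := fun ρ => Poly.eval p ρ ^ 2) (g := fun _ => K)
    (((Poly.continuous_eval p).pow 2).intervalIntegrable _ _) (continuous_const.intervalIntegrable _ _),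
    intervalIntegral.integral_const, smul_eq_mul]
  have hp2 : ∫ ρ in a..b, Poly.eval p ρ ^ 2 =
      Poly.eval (Poly.ad 0 (Poly.mul p p)) b - Poly.eval (Poly.ad 0 (Poly.mul p p)) a := by
    rw [← integral_eq_sub_of_hasDerivAt (fun x _ => hasDerivAt_eval_ad_zero (Poly.mul p p) x)
      ((Poly.continuous_eval _).intervalIntegrable _ _)]
    exact intervalIntegral.integral_congr fun ρ _ => by simp only [Poly.eval_mul, pow_two]
  rw [hp2]

/-! ### The edge panel with a logarithmic singularity -/

/-- **Squared `L²` norm over an edge panel carrying `−½ q(s) log s`.**  Let `0 < h`, `2h ≤ 1`, `T` be enclosed on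
`|ρ| ≤ h` by `P`, `p, q` rational polynomials, and on `(0, 2h]` let `R(s) = −½ q(s) log s + T(h − s)` with `R²` interval
integrable.  Then, with `δ = tabsI S h (P − p)/S`, `ℓ = log(2h)`, `qq = q·q`, `qp = q·(shift p h)` (`= q(s)p(h−s)`),
`∫₀^{2h} R² ≤ ¼(pm₁[qq]ℓ² − 2pm₂[qq]ℓ + 2pm₃[qq]) − (pm₁[qp]ℓ − pm₂[qp]) + integPolyQ p p h + δ·‖q‖_{2h}·2h(1 − ℓ)
 + 2h(2‖p‖_h δ + δ²)`. [folklore] -/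
theorem integral_sq_logEdge_le {S : ℕ} (hS : 0 < S) {h : ℚ} (h0 : 0 < h) (h21 : 2 * h ≤ 1) {R T : ℝ → ℝ}
    {P : IPoly} (hT : TMem S h T P) (q p : Poly)
    (hR : ∀ s ∈ Ioc (0 : ℝ) (2 * h), R s = -(1 / 2) * Poly.eval q s * Real.log s + T ((h : ℝ) - s))
    (hRi : IntervalIntegrable (fun s => R s ^ 2) volume 0 (2 * h)) :
    ∫ s in (0 : ℝ)..(2 * h), R s ^ 2 ≤
      (1 / 4) * ((powMomQ (Poly.mul q q) (2 * h) 1 : ℝ) * Real.log (2 * h) ^ 2 -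
          2 * (powMomQ (Poly.mul q q) (2 * h) 2 : ℝ) * Real.log (2 * h) + 2 * (powMomQ (Poly.mul q q) (2 * h) 3 : ℝ)) -
        ((powMomQ (Poly.mul q (Poly.shift p h)) (2 * h) 1 : ℝ) * Real.log (2 * h) -
          (powMomQ (Poly.mul q (Poly.shift p h)) (2 * h) 2 : ℝ)) +
        (integPolyQ p p h : ℝ) +
        ((tabsI S h (tsubI P (ratPolyI S p)) : ℝ) / S) * absBoundQ q (2 * h) * (2 * h * (1 - Real.log (2 * h))) +
        2 * h * (2 * absBoundQ p h * ((tabsI S h (tsubI P (ratPolyI S p)) : ℝ) / S) +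
          ((tabsI S h (tsubI P (ratPolyI S p)) : ℝ) / S) ^ 2) := by
  set δ : ℝ := (tabsI S h (tsubI P (ratPolyI S p)) : ℝ) / S with hδ
  set K : ℝ := 2 * absBoundQ p h * δ + δ ^ 2 with hK
  set Q : ℝ := (absBoundQ q (2 * h) : ℝ) with hQ
  have hSr : (0 : ℝ) < S := by exact_mod_cast hS
  have hhr : (0 : ℝ) < h := by exact_mod_cast h0
  have h2h : (0 : ℝ) < 2 * h := by positivity
  have h2h1 : (2 * (h : ℝ)) ≤ 1 := by exact_mod_cast h21
  have h2cast : ((2 * h : ℚ) : ℝ) = 2 * (h : ℝ) := by push_cast; ring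
  have hδ0 : 0 ≤ δ := (abs_nonneg _).trans (abs_sub_poly_le_of_tmem hS h0.le hT p (by
    rw [abs_zero]; exact hhr.le : |(0 : ℝ)| ≤ h))
  -- pointwise bound on `(0, 2h]`
  have hpt : ∀ s ∈ Ioc (0 : ℝ) (2 * h), R s ^ 2 ≤
      (1 / 4) * (Poly.eval (Poly.mul q q) s * Real.log s ^ 2) -
        Poly.eval (Poly.mul q (Poly.shift p h)) s * Real.log s +
        Poly.eval (Poly.shift p h) s ^ 2 + δ * Q * (-Real.log s) + K := by
    intro s hs
    have hs1 : s ≤ 1 := hs.2.trans h2h1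
    have hlog : Real.log s ≤ 0 := Real.log_nonpos hs.1.le hs1
    have hnl : 0 ≤ -Real.log s := by linarith
    have hu : |(h : ℝ) - s| ≤ h := abs_le.2 ⟨by linarith [hs.2], by linarith [hs.1]⟩
    have hε : |T ((h : ℝ) - s) - Poly.eval p ((h : ℝ) - s)| ≤ δ := abs_sub_poly_le_of_tmem hS h0.le hT p hu
    have hpA : |Poly.eval p ((h : ℝ) - s)| ≤ (absBoundQ p h : ℝ) := abs_eval_le_absBoundQ p hu
    have hqQ : |Poly.eval q s| ≤ Q :=
      abs_eval_le_absBoundQ q (abs_le.2 ⟨by rw [h2cast]; linarith [hs.1], by rw [h2cast]; exact hs.2⟩)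
    have hQ0 : 0 ≤ Q := (abs_nonneg _).trans hqQ
    have hA0 : 0 ≤ (absBoundQ p h : ℝ) := (abs_nonneg _).trans hpA
    rw [hR s hs]
    simp only [Poly.eval_mul, eval_shift_eq]
    -- abbreviations: a = q(s), l = log s, b = p(h−s), e = T(h−s) − p(h−s)
    have h1 : Poly.eval q s * (T ((h : ℝ) - s) - Poly.eval p ((h : ℝ) - s)) * (-Real.log s) ≤ Q * δ * (-Real.log s) := by
      refine mul_le_mul_of_nonneg_right ?_ hnl
      calc Poly.eval q s * (T ((h : ℝ) - s) - Poly.eval p ((h : ℝ) - s))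
          ≤ |Poly.eval q s * (T ((h : ℝ) - s) - Poly.eval p ((h : ℝ) - s))| := le_abs_self _
        _ = |Poly.eval q s| * |T ((h : ℝ) - s) - Poly.eval p ((h : ℝ) - s)| := abs_mul _ _
        _ ≤ Q * δ := mul_le_mul hqQ hε (abs_nonneg _) hQ0
    have h2 : Poly.eval p ((h : ℝ) - s) * (T ((h : ℝ) - s) - Poly.eval p ((h : ℝ) - s)) ≤ absBoundQ p h * δ := by
      calc Poly.eval p ((h : ℝ) - s) * (T ((h : ℝ) - s) - Poly.eval p ((h : ℝ) - s))
          ≤ |Poly.eval p ((h : ℝ) - s) * (T ((h : ℝ) - s) - Poly.eval p ((h : ℝ) - s))| := le_abs_self _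
        _ = |Poly.eval p ((h : ℝ) - s)| * |T ((h : ℝ) - s) - Poly.eval p ((h : ℝ) - s)| := abs_mul _ _
        _ ≤ absBoundQ p h * δ := mul_le_mul hpA hε (abs_nonneg _) hA0
    have h3 : (T ((h : ℝ) - s) - Poly.eval p ((h : ℝ) - s)) ^ 2 ≤ δ ^ 2 := by
      rw [← sq_abs]; exact pow_le_pow_left₀ (abs_nonneg _) hε 2
    have key : (-(1 / 2) * Poly.eval q s * Real.log s + T ((h : ℝ) - s)) ^ 2 =
        (1 / 4) * (Poly.eval q s * Poly.eval q s * Real.log s ^ 2) -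
          Poly.eval q s * Poly.eval p ((h : ℝ) - s) * Real.log s + Poly.eval p ((h : ℝ) - s) ^ 2 +
        (Poly.eval q s * (T ((h : ℝ) - s) - Poly.eval p ((h : ℝ) - s)) * (-Real.log s) +
          2 * (Poly.eval p ((h : ℝ) - s) * (T ((h : ℝ) - s) - Poly.eval p ((h : ℝ) - s))) +
          (T ((h : ℝ) - s) - Poly.eval p ((h : ℝ) - s)) ^ 2) := by ring
    rw [key, hK]
    nlinarith [h1, h2, h3]
  -- integrability of the dominating integrand
  have hqq := (intervalIntegrable_pow_mul_log_sq 0 h2h.le h2h1).continuousOn_mul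
    (Poly.continuous_eval (Poly.mul q q)).continuousOn
  have hqp := (intervalIntegrable_pow_mul_log 0 (2 * (h : ℝ))).continuousOn_mul
    (Poly.continuous_eval (Poly.mul q (Poly.shift p h))).continuousOn
  have hI_A : IntervalIntegrable (fun s : ℝ => (1 / 4) * (Poly.eval (Poly.mul q q) s * Real.log s ^ 2)) volume 0 (2 * h) := by
    refine (hqq.const_mul (1 / 4)).congr fun s _ => ?_
    simp only [pow_zero, one_mul]
  have hI_B : IntervalIntegrable (fun s : ℝ => Poly.eval (Poly.mul q (Poly.shift p h)) s * Real.log s) volume 0 (2 * h) := by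
    refine hqp.congr fun s _ => ?_
    simp only [pow_zero, one_mul]
  have hI_C : IntervalIntegrable (fun s : ℝ => Poly.eval (Poly.shift p h) s ^ 2) volume 0 (2 * h) :=
    ((Poly.continuous_eval _).pow 2).intervalIntegrable _ _
  have hI_D : IntervalIntegrable (fun s : ℝ => δ * Q * (-Real.log s)) volume 0 (2 * h) :=
    intervalIntegral.intervalIntegrable_log'.neg.const_mul _
  have hI_E : IntervalIntegrable (fun _ : ℝ => K) volume 0 (2 * h) := continuous_const.intervalIntegrable _ _
  have hGi := (((hI_A.sub hI_B).add hI_C).add hI_D).add hI_E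
  -- integrate
  have hmono : ∫ s in (0 : ℝ)..(2 * h), R s ^ 2 ≤ ∫ s in (0 : ℝ)..(2 * h),
      ((1 / 4) * (Poly.eval (Poly.mul q q) s * Real.log s ^ 2) -
        Poly.eval (Poly.mul q (Poly.shift p h)) s * Real.log s +
        Poly.eval (Poly.shift p h) s ^ 2 + δ * Q * (-Real.log s) + K) := by
    refine intervalIntegral.integral_mono_ae_restrict h2h.le hRi hGi ?_
    rw [EventuallyLE, ae_restrict_iff' measurableSet_Icc]
    have hne : ∀ᵐ s : ℝ ∂volume, s ≠ 0 := by
      rw [ae_iff]; simp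
    filter_upwards [hne] with s hs0 hs
    exact hpt s ⟨lt_of_le_of_ne hs.1 (Ne.symm hs0), hs.2⟩
  refine hmono.trans (le_of_eq ?_)
  rw [intervalIntegral.integral_add (((hI_A.sub hI_B).add hI_C).add hI_D) hI_E,
    intervalIntegral.integral_add ((hI_A.sub hI_B).add hI_C) hI_D,
    intervalIntegral.integral_add (hI_A.sub hI_B) hI_C, intervalIntegral.integral_sub hI_A hI_B]
  have eA : ∫ s in (0 : ℝ)..(2 * h), (1 / 4) * (Poly.eval (Poly.mul q q) s * Real.log s ^ 2) =
      (1 / 4) * ((powMomQ (Poly.mul q q) (2 * h) 1 : ℝ) * Real.log (2 * h) ^ 2 -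
        2 * (powMomQ (Poly.mul q q) (2 * h) 2 : ℝ) * Real.log (2 * h) + 2 * (powMomQ (Poly.mul q q) (2 * h) 3 : ℝ)) := by
    rw [intervalIntegral.integral_const_mul]
    have h := integral_poly_mul_log_sq (Poly.mul q q) (L := 2 * h) (by positivity) h21
    rw [h2cast] at h
    rw [h]
  have eB : ∫ s in (0 : ℝ)..(2 * h), Poly.eval (Poly.mul q (Poly.shift p h)) s * Real.log s =
      (powMomQ (Poly.mul q (Poly.shift p h)) (2 * h) 1 : ℝ) * Real.log (2 * h) -
        (powMomQ (Poly.mul q (Poly.shift p h)) (2 * h) 2 : ℝ) := by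
    have h := integral_poly_mul_log (Poly.mul q (Poly.shift p h)) (L := 2 * h) (by positivity)
    rw [h2cast] at h
    exact h
  have eC : ∫ s in (0 : ℝ)..(2 * h), Poly.eval (Poly.shift p h) s ^ 2 = (integPolyQ p p h : ℝ) := by
    have e1 : ∫ s in (0 : ℝ)..(2 * h), Poly.eval (Poly.shift p h) s ^ 2 =
        ∫ s in (0 : ℝ)..(2 * h), Poly.eval p ((h : ℝ) - s) ^ 2 :=
      intervalIntegral.integral_congr fun s _ => by rw [eval_shift_eq]
    have hsub := intervalIntegral.integral_comp_sub_left (fun ρ : ℝ => Poly.eval p ρ ^ 2) (h : ℝ) (a := 0) (b := 2 * h)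
    simp only [sub_zero] at hsub
    rw [show (h : ℝ) - 2 * h = -h by ring] at hsub
    rw [e1, hsub, ← integral_eval_mul_eval]
    exact intervalIntegral.integral_congr fun ρ _ => by simp only [pow_two]
  have eD : ∫ s in (0 : ℝ)..(2 * h), δ * Q * (-Real.log s) = δ * Q * (2 * h * (1 - Real.log (2 * h))) := by
    rw [intervalIntegral.integral_const_mul, integral_neg_log]
  have eE : ∫ _ in (0 : ℝ)..(2 * h), K = 2 * h * K := by
    rw [intervalIntegral.integral_const, smul_eq_mul]; ring
  rw [eA, eB, eC, eD, eE, hK, hQ]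

/-- (Localised variant: `‖q‖` over `[0, 2h]` only, via the re-centred `absBoundQ (shift q h) h` — a window polynomial
continued outside the window explodes, so `absBoundQ q (2h)` is useless there.)
 **Squared `L²` norm over an edge panel carrying `−½ q(s) log s`.**  Let `0 < h`, `2h ≤ 1`, `T` be enclosed on
`|ρ| ≤ h` by `P`, `p, q` rational polynomials, and on `(0, 2h]` let `R(s) = −½ q(s) log s + T(h − s)` with `R²` interval
integrable.  Then, with `δ = tabsI S h (P − p)/S`, `ℓ = log(2h)`, `qq = q·q`, `qp = q·(shift p h)` (`= q(s)p(h−s)`),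
`∫₀^{2h} R² ≤ ¼(pm₁[qq]ℓ² − 2pm₂[qq]ℓ + 2pm₃[qq]) − (pm₁[qp]ℓ − pm₂[qp]) + integPolyQ p p h + δ·‖q‖_{2h}·2h(1 − ℓ)
 + 2h(2‖p‖_h δ + δ²)`. [folklore] -/
theorem integral_sq_logEdge_le_loc {S : ℕ} (hS : 0 < S) {h : ℚ} (h0 : 0 < h) (h21 : 2 * h ≤ 1) {R T : ℝ → ℝ}
    {P : IPoly} (hT : TMem S h T P) (q p : Poly)
    (hR : ∀ s ∈ Ioc (0 : ℝ) (2 * h), R s = -(1 / 2) * Poly.eval q s * Real.log s + T ((h : ℝ) - s))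
    (hRi : IntervalIntegrable (fun s => R s ^ 2) volume 0 (2 * h)) :
    ∫ s in (0 : ℝ)..(2 * h), R s ^ 2 ≤
      (1 / 4) * ((powMomQ (Poly.mul q q) (2 * h) 1 : ℝ) * Real.log (2 * h) ^ 2 -
          2 * (powMomQ (Poly.mul q q) (2 * h) 2 : ℝ) * Real.log (2 * h) + 2 * (powMomQ (Poly.mul q q) (2 * h) 3 : ℝ)) -
        ((powMomQ (Poly.mul q (Poly.shift p h)) (2 * h) 1 : ℝ) * Real.log (2 * h) -
          (powMomQ (Poly.mul q (Poly.shift p h)) (2 * h) 2 : ℝ)) +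
        (integPolyQ p p h : ℝ) +
        ((tabsI S h (tsubI P (ratPolyI S p)) : ℝ) / S) * absBoundQ (Poly.shift q h) h * (2 * h * (1 - Real.log (2 * h))) +
        2 * h * (2 * absBoundQ p h * ((tabsI S h (tsubI P (ratPolyI S p)) : ℝ) / S) +
          ((tabsI S h (tsubI P (ratPolyI S p)) : ℝ) / S) ^ 2) := by
  set δ : ℝ := (tabsI S h (tsubI P (ratPolyI S p)) : ℝ) / S with hδ
  set K : ℝ := 2 * absBoundQ p h * δ + δ ^ 2 with hK
  set Q : ℝ := (absBoundQ (Poly.shift q h) h : ℝ) with hQ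
  have hSr : (0 : ℝ) < S := by exact_mod_cast hS
  have hhr : (0 : ℝ) < h := by exact_mod_cast h0
  have h2h : (0 : ℝ) < 2 * h := by positivity
  have h2h1 : (2 * (h : ℝ)) ≤ 1 := by exact_mod_cast h21
  have h2cast : ((2 * h : ℚ) : ℝ) = 2 * (h : ℝ) := by push_cast; ring
  have hδ0 : 0 ≤ δ := (abs_nonneg _).trans (abs_sub_poly_le_of_tmem hS h0.le hT p (by
    rw [abs_zero]; exact hhr.le : |(0 : ℝ)| ≤ h))
  -- pointwise bound on `(0, 2h]`
  have hpt : ∀ s ∈ Ioc (0 : ℝ) (2 * h), R s ^ 2 ≤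
      (1 / 4) * (Poly.eval (Poly.mul q q) s * Real.log s ^ 2) -
        Poly.eval (Poly.mul q (Poly.shift p h)) s * Real.log s +
        Poly.eval (Poly.shift p h) s ^ 2 + δ * Q * (-Real.log s) + K := by
    intro s hs
    have hs1 : s ≤ 1 := hs.2.trans h2h1
    have hlog : Real.log s ≤ 0 := Real.log_nonpos hs.1.le hs1
    have hnl : 0 ≤ -Real.log s := by linarith
    have hu : |(h : ℝ) - s| ≤ h := abs_le.2 ⟨by linarith [hs.2], by linarith [hs.1]⟩
    have hε : |T ((h : ℝ) - s) - Poly.eval p ((h : ℝ) - s)| ≤ δ := abs_sub_poly_le_of_tmem hS h0.le hT p hu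
    have hpA : |Poly.eval p ((h : ℝ) - s)| ≤ (absBoundQ p h : ℝ) := abs_eval_le_absBoundQ p hu
    have hqQ : |Poly.eval q s| ≤ Q := by
      have e : Poly.eval q s = Poly.eval (Poly.shift q h) ((h : ℝ) - s) := by
        rw [eval_shift_eq]; congr 1; ring
      rw [e]
      exact abs_eval_le_absBoundQ _ (abs_le.2 ⟨by linarith [hs.2], by linarith [hs.1]⟩)
    have hQ0 : 0 ≤ Q := (abs_nonneg _).trans hqQ
    have hA0 : 0 ≤ (absBoundQ p h : ℝ) := (abs_nonneg _).trans hpA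
    rw [hR s hs]
    simp only [Poly.eval_mul, eval_shift_eq]
    -- abbreviations: a = q(s), l = log s, b = p(h−s), e = T(h−s) − p(h−s)
    have h1 : Poly.eval q s * (T ((h : ℝ) - s) - Poly.eval p ((h : ℝ) - s)) * (-Real.log s) ≤ Q * δ * (-Real.log s) := by
      refine mul_le_mul_of_nonneg_right ?_ hnl
      calc Poly.eval q s * (T ((h : ℝ) - s) - Poly.eval p ((h : ℝ) - s))
          ≤ |Poly.eval q s * (T ((h : ℝ) - s) - Poly.eval p ((h : ℝ) - s))| := le_abs_self _
        _ = |Poly.eval q s| * |T ((h : ℝ) - s) - Poly.eval p ((h : ℝ) - s)| := abs_mul _ _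
        _ ≤ Q * δ := mul_le_mul hqQ hε (abs_nonneg _) hQ0
    have h2 : Poly.eval p ((h : ℝ) - s) * (T ((h : ℝ) - s) - Poly.eval p ((h : ℝ) - s)) ≤ absBoundQ p h * δ := by
      calc Poly.eval p ((h : ℝ) - s) * (T ((h : ℝ) - s) - Poly.eval p ((h : ℝ) - s))
          ≤ |Poly.eval p ((h : ℝ) - s) * (T ((h : ℝ) - s) - Poly.eval p ((h : ℝ) - s))| := le_abs_self _
        _ = |Poly.eval p ((h : ℝ) - s)| * |T ((h : ℝ) - s) - Poly.eval p ((h : ℝ) - s)| := abs_mul _ _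
        _ ≤ absBoundQ p h * δ := mul_le_mul hpA hε (abs_nonneg _) hA0
    have h3 : (T ((h : ℝ) - s) - Poly.eval p ((h : ℝ) - s)) ^ 2 ≤ δ ^ 2 := by
      rw [← sq_abs]; exact pow_le_pow_left₀ (abs_nonneg _) hε 2
    have key : (-(1 / 2) * Poly.eval q s * Real.log s + T ((h : ℝ) - s)) ^ 2 =
        (1 / 4) * (Poly.eval q s * Poly.eval q s * Real.log s ^ 2) -
          Poly.eval q s * Poly.eval p ((h : ℝ) - s) * Real.log s + Poly.eval p ((h : ℝ) - s) ^ 2 +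
        (Poly.eval q s * (T ((h : ℝ) - s) - Poly.eval p ((h : ℝ) - s)) * (-Real.log s) +
          2 * (Poly.eval p ((h : ℝ) - s) * (T ((h : ℝ) - s) - Poly.eval p ((h : ℝ) - s))) +
          (T ((h : ℝ) - s) - Poly.eval p ((h : ℝ) - s)) ^ 2) := by ring
    rw [key, hK]
    nlinarith [h1, h2, h3]
  -- integrability of the dominating integrand
  have hqq := (intervalIntegrable_pow_mul_log_sq 0 h2h.le h2h1).continuousOn_mul
    (Poly.continuous_eval (Poly.mul q q)).continuousOn
  have hqp := (intervalIntegrable_pow_mul_log 0 (2 * (h : ℝ))).continuousOn_mul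
    (Poly.continuous_eval (Poly.mul q (Poly.shift p h))).continuousOn
  have hI_A : IntervalIntegrable (fun s : ℝ => (1 / 4) * (Poly.eval (Poly.mul q q) s * Real.log s ^ 2)) volume 0 (2 * h) := by
    refine (hqq.const_mul (1 / 4)).congr fun s _ => ?_
    simp only [pow_zero, one_mul]
  have hI_B : IntervalIntegrable (fun s : ℝ => Poly.eval (Poly.mul q (Poly.shift p h)) s * Real.log s) volume 0 (2 * h) := by
    refine hqp.congr fun s _ => ?_
    simp only [pow_zero, one_mul]
  have hI_C : IntervalIntegrable (fun s : ℝ => Poly.eval (Poly.shift p h) s ^ 2) volume 0 (2 * h) :=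
    ((Poly.continuous_eval _).pow 2).intervalIntegrable _ _
  have hI_D : IntervalIntegrable (fun s : ℝ => δ * Q * (-Real.log s)) volume 0 (2 * h) :=
    intervalIntegral.intervalIntegrable_log'.neg.const_mul _
  have hI_E : IntervalIntegrable (fun _ : ℝ => K) volume 0 (2 * h) := continuous_const.intervalIntegrable _ _
  have hGi := (((hI_A.sub hI_B).add hI_C).add hI_D).add hI_E
  -- integrate
  have hmono : ∫ s in (0 : ℝ)..(2 * h), R s ^ 2 ≤ ∫ s in (0 : ℝ)..(2 * h),
      ((1 / 4) * (Poly.eval (Poly.mul q q) s * Real.log s ^ 2) -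
        Poly.eval (Poly.mul q (Poly.shift p h)) s * Real.log s +
        Poly.eval (Poly.shift p h) s ^ 2 + δ * Q * (-Real.log s) + K) := by
    refine intervalIntegral.integral_mono_ae_restrict h2h.le hRi hGi ?_
    rw [EventuallyLE, ae_restrict_iff' measurableSet_Icc]
    have hne : ∀ᵐ s : ℝ ∂volume, s ≠ 0 := by
      rw [ae_iff]; simp
    filter_upwards [hne] with s hs0 hs
    exact hpt s ⟨lt_of_le_of_ne hs.1 (Ne.symm hs0), hs.2⟩
  refine hmono.trans (le_of_eq ?_)
  rw [intervalIntegral.integral_add (((hI_A.sub hI_B).add hI_C).add hI_D) hI_E,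
    intervalIntegral.integral_add ((hI_A.sub hI_B).add hI_C) hI_D,
    intervalIntegral.integral_add (hI_A.sub hI_B) hI_C, intervalIntegral.integral_sub hI_A hI_B]
  have eA : ∫ s in (0 : ℝ)..(2 * h), (1 / 4) * (Poly.eval (Poly.mul q q) s * Real.log s ^ 2) =
      (1 / 4) * ((powMomQ (Poly.mul q q) (2 * h) 1 : ℝ) * Real.log (2 * h) ^ 2 -
        2 * (powMomQ (Poly.mul q q) (2 * h) 2 : ℝ) * Real.log (2 * h) + 2 * (powMomQ (Poly.mul q q) (2 * h) 3 : ℝ)) := by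
    rw [intervalIntegral.integral_const_mul]
    have h := integral_poly_mul_log_sq (Poly.mul q q) (L := 2 * h) (by positivity) h21
    rw [h2cast] at h
    rw [h]
  have eB : ∫ s in (0 : ℝ)..(2 * h), Poly.eval (Poly.mul q (Poly.shift p h)) s * Real.log s =
      (powMomQ (Poly.mul q (Poly.shift p h)) (2 * h) 1 : ℝ) * Real.log (2 * h) -
        (powMomQ (Poly.mul q (Poly.shift p h)) (2 * h) 2 : ℝ) := by
    have h := integral_poly_mul_log (Poly.mul q (Poly.shift p h)) (L := 2 * h) (by positivity)
    rw [h2cast] at h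
    exact h
  have eC : ∫ s in (0 : ℝ)..(2 * h), Poly.eval (Poly.shift p h) s ^ 2 = (integPolyQ p p h : ℝ) := by
    have e1 : ∫ s in (0 : ℝ)..(2 * h), Poly.eval (Poly.shift p h) s ^ 2 =
        ∫ s in (0 : ℝ)..(2 * h), Poly.eval p ((h : ℝ) - s) ^ 2 :=
      intervalIntegral.integral_congr fun s _ => by rw [eval_shift_eq]
    have hsub := intervalIntegral.integral_comp_sub_left (fun ρ : ℝ => Poly.eval p ρ ^ 2) (h : ℝ) (a := 0) (b := 2 * h)
    simp only [sub_zero] at hsub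
    rw [show (h : ℝ) - 2 * h = -h by ring] at hsub
    rw [e1, hsub, ← integral_eval_mul_eval]
    exact intervalIntegral.integral_congr fun ρ _ => by simp only [pow_two]
  have eD : ∫ s in (0 : ℝ)..(2 * h), δ * Q * (-Real.log s) = δ * Q * (2 * h * (1 - Real.log (2 * h))) := by
    rw [intervalIntegral.integral_const_mul, integral_neg_log]
  have eE : ∫ _ in (0 : ℝ)..(2 * h), K = 2 * h * K := by
    rw [intervalIntegral.integral_const, smul_eq_mul]; ring
  rw [eA, eB, eC, eD, eE, hK, hQ]

end PolyMP

end Literature.Analysis.ValidatedNumerics
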